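import Summits.CriticalPhenomena.CardyFormulaZ2.Theses.CardyQContinuation

/-!
# The `n = 1` face of the higher-jet existence stub is the crux `FirstJetConverges`

Crux `IsingJetsConformal` (stmt-CriticalPhenomena-5560), line `registered`, stub `stub_higherJetLimitsExist`
("for every `n ≥ 1` and every conformal rectangle the `n`-th `s`-jet of the self-dual FK crossing
ratio `P_δ` at `s = √2` has a limit as `δ → 0⁺`"). This file records, machine-checked, the
containment used by the lead's census: the `n = 1` instance of that stub is — up to
`iteratedDeriv_one` — VERBATIM the route's rank-5 crux `FirstJetConverges`
(stmt-CriticalPhenomena-5561), in both directions. So the stub is at least crux-sized, and any proof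
or refutation of `FirstJetConverges` is one of its `n = 1` face.
-/

namespace Summit.CriticalPhenomena.CardyFormulaZ2.Theorems.CardyQContinuation

open Filter
open scoped Topology
open Summit.CriticalPhenomena.CardyFormulaZ2.Theses.CardyQContinuation

/-- **`stub_higherJetLimitsExist` ⇒ `FirstJetConverges`**: the higher-jet existence statement of line
`registered` of crux stmt-CriticalPhenomena-5560 (all `n ≥ 1`, hypothesis spelled out in the route's
inline vocabulary) gives, at `n = 1` and after `iteratedDeriv_one`, the route's crux
`FirstJetConverges` (stmt-CriticalPhenomena-5561). [folklore] -/
theorem firstJetConverges_of_higherJetLimitsExist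
    (hE : (let w : Literature.Probability.RandomPlanarGeometry.ConformalRectangle → ℝ → ℂ → Set (Sym2 (Literature.Probability.LatticeModels.Site 2)) → ℂ := fun R δ s ω ↦ s ^ (ω.ncard + 2 * Nat.card ((Literature.Probability.Percolation.openGraph ω ⊔ Literature.Probability.LatticeModels.wired (Literature.Probability.LatticeModels.discreteArc R.carrier δ (R.arc 0) ∪ Literature.Probability.LatticeModels.discreteArc R.carrier δ (R.arc 2))).induce (Literature.Probability.LatticeModels.meshDomain R.carrier δ)).ConnectedComponent); let P : Literature.Probability.RandomPlanarGeometry.ConformalRectangle → ℝ → ℂ → ℂ := fun R δ s ↦ (∑ᶠ ω ∈ 𝒫 (Literature.Probability.LatticeModels.discreteDomainGraph R.carrier δ).edgeSet, (Literature.Probability.Percolation.discreteCrossing R.carrier δ (R.arc 0) (R.arc 2)).indicator (w R δ s) ω) / (∑ᶠ ω ∈ 𝒫 (Literature.Probability.LatticeModels.discreteDomainGraph R.carrier δ).edgeSet, w R δ s ω); ∀ n : ℕ, 1 ≤ n → ∀ R : Literature.Probability.RandomPlanarGeometry.ConformalRectangle, ∃ L : ℂ, Filter.Tendsto (fun δ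 ↦ iteratedDeriv n (P R δ) (Real.sqrt 2 : ℂ)) (nhdsWithin 0 (Set.Ioi 0)) (nhds L))) :
    FirstJetConverges := by
  intro R
  obtain ⟨L, hL⟩ := hE 1 le_rfl R
  refine ⟨L, ?_⟩
  simpa only [iteratedDeriv_one] using hL

/-- **`FirstJetConverges` ⇒ the `n = 1` instance of `stub_higherJetLimitsExist`** (converse of
`firstJetConverges_of_higherJetLimitsExist` at `n = 1`): the two statements are the same up to
`iteratedDeriv_one`. [folklore] -/
theorem higherJetLimitsExist_one_of_firstJetConverges (h : FirstJetConverges) :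
    (let w : Literature.Probability.RandomPlanarGeometry.ConformalRectangle → ℝ → ℂ → Set (Sym2 (Literature.Probability.LatticeModels.Site 2)) → ℂ := fun R δ s ω ↦ s ^ (ω.ncard + 2 * Nat.card ((Literature.Probability.Percolation.openGraph ω ⊔ Literature.Probability.LatticeModels.wired (Literature.Probability.LatticeModels.discreteArc R.carrier δ (R.arc 0) ∪ Literature.Probability.LatticeModels.discreteArc R.carrier δ (R.arc 2))).induce (Literature.Probability.LatticeModels.meshDomain R.carrier δ)).ConnectedComponent); let P : Literature.Probability.RandomPlanarGeometry.ConformalRectangle → ℝ → ℂ → ℂ := fun R δ s ↦ (∑ᶠ ω ∈ 𝒫 (Literature.Probability.LatticeModels.discreteDomainGraph R.carrier δ).edgeSet, (Literature.Probability.Percolation.discreteCrossing R.carrier δ (R.arc 0) (R.arc 2)).indicator (w R δ s) ω) / (∑ᶠ ω ∈ 𝒫 (Literature.Probability.LatticeModels.discreteDomainGraph R.carrier δ).edgeSet, w R δ s ω); ∀ R : Literature.Probability.RandomPlanarGeometry.ConformalRectangle, ∃ L : ℂ, Filter.Tendsto (fun δ ↦ iteratedDeriv 1 (P R δ) (Real.sqrt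 2 : ℂ)) (nhdsWithin 0 (Set.Ioi 0)) (nhds L)) := by
  have h' := h
  dsimp only [FirstJetConverges] at h'
  intro w P R
  obtain ⟨c, hc⟩ := h' R
  refine ⟨c, ?_⟩
  simpa only [iteratedDeriv_one] using hc

end Summit.CriticalPhenomena.CardyFormulaZ2.Theorems.CardyQContinuation
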